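import Mathlib
import Summits.ValiantsHypothesis.ValiantsHypothesis.Theorems.RigidityForcesSymmetryRankRigidMinimalReprLaplaceFiveSeparatedCapturePlane
import Summits.ValiantsHypothesis.ValiantsHypothesis.Theorems.RigidityForcesSymmetryRankRigidMinimalReprLaplaceFiveSeparatedCaptureTwoK2Hub
import Summits.ValiantsHypothesis.ValiantsHypothesis.Theorems.RigidityForcesSymmetryRankRigidMinimalReprLaplaceFiveSeparatedCaptureLeadingMonomials

/-!
# ValiantsHypothesis / RigidityForcesSymmetry — crux `LaplaceOptimalFive` (stmt-ValiantsHypothesis-24813), symmetric capture: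
# **REDUCTION TO THE PAIR PART** (`dim W ≤ dim AB` whenever the third triangle span is a plane)

Brick R1 of the profile-`(·,·,2)` analysis of `CaptureIneqSym` (memo `pub/val-lit/lmr/NOTE-port2g5-24813-profile112-readout.md`;
val-port-2 g5 ↔ crit-3 g8, 2026-08-29).  Every captured obligation reads `T_μ = A + B + C` with `A(·,·,r) ∈ U₀₁`, `B(·,r,·) ∈ U₀₂`
(any shape — only the PAIR `(A, B)` matters here) and third part `C` with slices `C(p,·,·)` in `U₁₂`.  If `U₁₂` lies in the span of two
symmetric matrices, then the pair part DETERMINES the obligation: two representations with the same `(A, B)` differ by a symmetric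
square-free tensor with all slices in a plane of quadrics, which vanishes (✓ `sqfree_slices_in_plane_eq_zero`).  Linear-algebra
packaging: if every obligation of `W` admits a representation whose pair part lies in a given submodule `AB`, then
`finrank W ≤ finrank AB` (rank–nullity on the representation space: the kernel of `(A,B,C) ↦ (A,B)` sits inside the kernel of
`(A,B,C) ↦ A + B + C`).  Specialisations: pair parts `u₁(p,q)a_r`, `u₂(p,r)b_q` placed on two fixed matrices with the vector pair
`(a, b)` in a submodule of `ℂ⁵ × ℂ⁵` (profiles `(1,1,2)`), and with `a, b` in a common subspace `Y ⊂ ℂ⁵` (`finrank W ≤ 2·finrank Y`;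
the binary-plane branch of `(1,1,2)` is `finrank Y ≤ 2`).

* `finrank_map_le_of_ker_le`, `finrank_map_le_of_ker_inf_le` — rank–nullity comparison of two images of one submodule
  (`ker π ⊓ R ≤ ker Φ ⇒ finrank Φ(R) ≤ finrank π(R)`; no tensors).
* ★ `finrank_le_of_pairPart` — the reduction, general pair parts (`U₁₂` in the span of two symmetric matrices).
* ★ `finrank_le_of_pairs_mem` — the instance in `CaptureIneqSym` currency (`finrank U₁₂ ≤ 2`, `W` captured by `L3 U₀₁ U₀₂ U₁₂`,
  any `AB` containing the placed pair parts of all finite-form representations); `pairPart_pencil` — the pair part satisfies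
  the `(1 2)`-symmetry (pencil) equations.
* `finrank_le_of_vectorPart` — pair parts `u₁ ⊗ a`, `u₂ ⊗ b`, `(a, b)` in a submodule of `ℂ⁵ × ℂ⁵`.
* `finrank_le_two_mul_of_vectors_mem` — `a, b ∈ Y` ⇒ `finrank W ≤ 2 · finrank Y`.
* `vectors_form_of_mem_L3` — reading of `L₃(ℂu₁, ℂu₂, U₁₂)` membership; `exists_pair_of_finrank_le_two` — a space of symmetric
  matrices of dimension `≤ 2` lies in the span of two symmetric matrices (the shape of the hypothesis `hV`).

Honest framing.  A reduction lemma; `CaptureIneqSym` (even its profile `(1,1,2)`), K1 on `K₃ ⊔ K₂`, `LaplaceOptimalFive`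
(OPEN · CONTESTED 72/120) and `VP ≠ VNP` are NOT proved here.  No definitions, no `sorry`.
-/

set_option linter.dupNamespace false
set_option autoImplicit false

namespace Summit.ValiantsHypothesis.ValiantsHypothesis.Theorems.RigidityForcesSymmetryRankRigidMinimalRepr

namespace LaplaceFiveSeparatedCapture

open Finset

/-- Rank–nullity comparison: if, on a submodule `R`, the kernel of `π` is contained in the kernel of `Φ`, then
`finrank Φ(R) ≤ finrank π(R)`. [folklore] -/
theorem finrank_map_le_of_ker_le {X E Y : Type*} [AddCommGroup X] [Module ℂ X] [AddCommGroup E] [Module ℂ E]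
    [AddCommGroup Y] [Module ℂ Y] [FiniteDimensional ℂ X]
    (Φ : X →ₗ[ℂ] E) (π : X →ₗ[ℂ] Y) (R : Submodule ℂ X) (h : ∀ x ∈ R, π x = 0 → Φ x = 0) :
    Module.finrank ℂ (R.map Φ) ≤ Module.finrank ℂ (R.map π) := by
  have e1 := LinearMap.finrank_range_add_finrank_ker (Φ.domRestrict R)
  have e2 := LinearMap.finrank_range_add_finrank_ker (π.domRestrict R)
  rw [LinearMap.range_domRestrict] at e1 e2
  have hk : LinearMap.ker (π.domRestrict R) ≤ LinearMap.ker (Φ.domRestrict R) := fun x hx => by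
    rw [LinearMap.mem_ker, LinearMap.domRestrict_apply] at hx ⊢
    exact h x.1 x.2 hx
  have := Submodule.finrank_mono hk
  omega

/-- The same comparison with the hypothesis written as `ker π ⊓ R ≤ ker Φ`. [folklore] -/
theorem finrank_map_le_of_ker_inf_le {X E Y : Type*} [AddCommGroup X] [Module ℂ X] [AddCommGroup E] [Module ℂ E]
    [AddCommGroup Y] [Module ℂ Y] [FiniteDimensional ℂ X]
    (Φ : X →ₗ[ℂ] E) (π : X →ₗ[ℂ] Y) (R : Submodule ℂ X) (h : LinearMap.ker π ⊓ R ≤ LinearMap.ker Φ) :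
    Module.finrank ℂ (R.map Φ) ≤ Module.finrank ℂ (R.map π) :=
  finrank_map_le_of_ker_le Φ π R fun _ hx hπ =>
    LinearMap.mem_ker.mp (h (Submodule.mem_inf.mpr ⟨LinearMap.mem_ker.mpr hπ, hx⟩))

/-- ★ **REDUCTION TO THE PAIR PART.**  Let `U₁₂` lie in the span of two symmetric matrices `v, v′`, and let every obligation
`T_μ` (`μ` in a space `W` of symmetric zero-diagonal leaf matrices) have a representation `T_μ = A + B + C` with `(A, B)` in a given
submodule `AB` and all slices `C(p,·,·)` in `U₁₂`.  Then `finrank W ≤ finrank AB`. [folklore] -/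
theorem finrank_le_of_pairPart (U12 W : Submodule ℂ (Fin 5 → Fin 5 → ℂ))
    (v v' : Fin 5 → Fin 5 → ℂ) (hv : ∀ p q, v p q = v q p) (hv' : ∀ p q, v' p q = v' q p)
    (hV : ∀ x ∈ U12, ∃ c c' : ℂ, x = c • v + c' • v')
    (hWs : ∀ μ ∈ W, ∀ s t : Fin 5, μ s t = μ t s) (hWd : ∀ μ ∈ W, ∀ s : Fin 5, μ s s = 0)
    (AB : Submodule ℂ ((Fin 5 → Fin 5 → Fin 5 → ℂ) × (Fin 5 → Fin 5 → Fin 5 → ℂ)))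
    (hrep : ∀ μ ∈ W, ∃ A B C : Fin 5 → Fin 5 → Fin 5 → ℂ, (A, B) ∈ AB ∧ (∀ p, C p ∈ U12) ∧
      contractZ μ = A + B + C) :
    Module.finrank ℂ W ≤ Module.finrank ℂ AB := by
  classical
  -- the representation space `X ∋ ((A, B), C)`, the assembly map `Φ` and the pair projection `π`
  let X := ((Fin 5 → Fin 5 → Fin 5 → ℂ) × (Fin 5 → Fin 5 → Fin 5 → ℂ)) × (Fin 5 → Fin 5 → Fin 5 → ℂ)
  let Φ : X →ₗ[ℂ] (Fin 5 → Fin 5 → Fin 5 → ℂ) :=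
    (LinearMap.fst ℂ _ _).comp (LinearMap.fst ℂ _ _) + (LinearMap.snd ℂ _ _).comp (LinearMap.fst ℂ _ _) + LinearMap.snd ℂ _ _
  let π : X →ₗ[ℂ] ((Fin 5 → Fin 5 → Fin 5 → ℂ) × (Fin 5 → Fin 5 → Fin 5 → ℂ)) := LinearMap.fst ℂ _ _
  have hΦ : ∀ x : X, Φ x = x.1.1 + x.1.2 + x.2 := fun x => rfl
  have hπ : ∀ x : X, π x = x.1 := fun x => rfl
  let Sl : Submodule ℂ X := ⨅ p : Fin 5, U12.comap ((LinearMap.proj p).comp (LinearMap.snd ℂ _ _))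
  have hSl : ∀ x : X, x ∈ Sl ↔ ∀ p, x.2 p ∈ U12 := fun x => by
    simp only [Sl, Submodule.mem_iInf, Submodule.mem_comap, LinearMap.comp_apply, LinearMap.proj_apply]
    exact Iff.rfl
  let R : Submodule ℂ X := ((W.map cZ).comap Φ ⊓ Sl) ⊓ AB.comap π
  -- the kernel of `π` on `R` lies in the kernel of `Φ` (✓ `sqfree_slices_in_plane_eq_zero`)
  have hker : ∀ x ∈ R, π x = 0 → Φ x = 0 := by
    intro x hx hπ0
    have hx1 := (Submodule.mem_inf.mp (Submodule.mem_inf.mp hx).1)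
    have hxW : Φ x ∈ W.map cZ := Submodule.mem_comap.mp hx1.1
    have hxS : ∀ p, x.2 p ∈ U12 := (hSl x).mp hx1.2
    rw [hπ] at hπ0
    have hA : x.1.1 = 0 := by rw [hπ0]; rfl
    have hB : x.1.2 = 0 := by rw [hπ0]; rfl
    have hΦx : Φ x = x.2 := by rw [hΦ, hA, hB, zero_add, zero_add]
    obtain ⟨μ, -, hμ⟩ := Submodule.mem_map.mp hxW
    rw [cZ_apply, hΦx] at hμ
    -- `x.2 = contractZ μ` is symmetric and square-free
    have h12 : ∀ p q r, x.2 p q r = x.2 q p r := fun p q r => by rw [← hμ]; exact (contractZ_swap12 μ p q r).symm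
    have h23 : ∀ p q r, x.2 p q r = x.2 p r q := fun p q r => by rw [← hμ]; exact (contractZ_swap23 μ p q r).symm
    have hsq : ∀ p r, x.2 p p r = 0 := fun p r => by rw [← hμ]; exact contractZ_rep12 μ p r
    have hc : ∀ p, ∃ c c' : ℂ, x.2 p = c • v + c' • v' := fun p => hV _ (hxS p)
    choose c c' hcc using hc
    -- reindex: `G a b r := x.2 r a b` has slices (last index) in the plane
    have hG : ∀ a b r, x.2 r a b = 0 := by
      intro a b r
      refine sqfree_slices_in_plane_eq_zero v v' hv hv' (fun a b r => x.2 r a b) (fun a b r => ?_) (fun a b r => ?_)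
        (fun a r => ?_) c c' (fun a b r => ?_) a b r
      · show x.2 r a b = x.2 r b a
        exact h23 r a b
      · show x.2 r a b = x.2 b a r
        rw [h12 r a b, h23 a r b, h12 a b r]
      · show x.2 r a a = 0
        rw [h12 r a a, h23 a r a]; exact hsq a r
      · show x.2 r a b = c r * v a b + c' r * v' a b
        rw [hcc r]; simp only [Pi.add_apply, Pi.smul_apply, smul_eq_mul]
    rw [hΦx]
    funext r a b
    exact hG a b r
  -- every obligation lies in `Φ(R)`
  have hmem : ∀ μ ∈ W, contractZ μ ∈ R.map Φ := by
    intro μ hμ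
    obtain ⟨A, B, C, hAB, hC, hT⟩ := hrep μ hμ
    refine Submodule.mem_map.mpr ⟨((A, B), C), ?_, ?_⟩
    · refine Submodule.mem_inf.mpr ⟨Submodule.mem_inf.mpr ⟨?_, (hSl _).mpr hC⟩, ?_⟩
      · rw [Submodule.mem_comap, hΦ]
        exact Submodule.mem_map.mpr ⟨μ, hμ, by rw [cZ_apply, hT]⟩
      · rw [Submodule.mem_comap, hπ]; exact hAB
    · rw [hΦ, hT]
  let f : W →ₗ[ℂ] (R.map Φ) := LinearMap.codRestrict (R.map Φ) (cZ.domRestrict W) (fun μ => by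
    simpa [cZ_apply] using hmem μ.1 μ.2)
  have hf : Function.Injective f := by
    rw [injective_iff_map_eq_zero]
    intro μ hμ
    have hT : contractZ μ.1 = 0 := by
      have := congrArg Subtype.val hμ
      simpa [f, cZ_apply] using this
    apply Subtype.ext
    refine hub_injective μ.1 (hWs μ.1 μ.2) (hWd μ.1 μ.2) fun p q => ?_
    simp [hT]
  have h1 := LinearMap.finrank_le_finrank_of_injective hf
  have h2 := finrank_map_le_of_ker_le Φ π R hker
  have h3 : Module.finrank ℂ (R.map π) ≤ Module.finrank ℂ AB :=
    Submodule.finrank_mono (Submodule.map_le_iff_le_comap.mpr inf_le_right)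
  omega

/-- **Vector pair version** (profiles `(1,1,·)` on the first two cuts).  If every obligation reads
`u₁(p,q)a_r + u₂(p,r)b_q + C_p(q,r)` with `(a, b)` in a submodule `AB ⊂ ℂ⁵ × ℂ⁵` and `C_p` in a span of two symmetric matrices, then
`finrank W ≤ finrank AB`. [folklore] -/
theorem finrank_le_of_vectorPart (u₁ u₂ : Fin 5 → Fin 5 → ℂ) (U12 W : Submodule ℂ (Fin 5 → Fin 5 → ℂ))
    (v v' : Fin 5 → Fin 5 → ℂ) (hv : ∀ p q, v p q = v q p) (hv' : ∀ p q, v' p q = v' q p)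
    (hV : ∀ x ∈ U12, ∃ c c' : ℂ, x = c • v + c' • v')
    (hWs : ∀ μ ∈ W, ∀ s t : Fin 5, μ s t = μ t s) (hWd : ∀ μ ∈ W, ∀ s : Fin 5, μ s s = 0)
    (AB : Submodule ℂ ((Fin 5 → ℂ) × (Fin 5 → ℂ)))
    (hrep : ∀ μ ∈ W, ∃ a b : Fin 5 → ℂ, ∃ C : Fin 5 → Fin 5 → Fin 5 → ℂ, (a, b) ∈ AB ∧ (∀ p, C p ∈ U12) ∧
      ∀ p q r, contractZ μ p q r = u₁ p q * a r + u₂ p r * b q + C p q r) :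
    Module.finrank ℂ W ≤ Module.finrank ℂ AB := by
  -- place the vector pair: `L (a, b) := (u₁ ⊗ a on slots 01·2, u₂ ⊗ b on slots 02·1)`
  let L : ((Fin 5 → ℂ) × (Fin 5 → ℂ)) →ₗ[ℂ] ((Fin 5 → Fin 5 → Fin 5 → ℂ) × (Fin 5 → Fin 5 → Fin 5 → ℂ)) :=
    { toFun := fun ab => (fun p q r => u₁ p q * ab.1 r, fun p q r => u₂ p r * ab.2 q)
      map_add' := fun x y => by
        ext p q r <;> simp only [Prod.fst_add, Prod.snd_add, Pi.add_apply, Prod.mk_add_mk] <;> ring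
      map_smul' := fun s x => by
        ext p q r <;> simp only [Prod.smul_fst, Prod.smul_snd, Pi.smul_apply, smul_eq_mul, RingHom.id_apply,
          Prod.smul_mk] <;> ring }
  have hL : ∀ ab : (Fin 5 → ℂ) × (Fin 5 → ℂ),
      L ab = (fun p q r => u₁ p q * ab.1 r, fun p q r => u₂ p r * ab.2 q) := fun ab => rfl
  have h := finrank_le_of_pairPart U12 W v v' hv hv' hV hWs hWd (AB.map L) (fun μ hμ => by
    obtain ⟨a, b, C, hab, hC, hT⟩ := hrep μ hμ
    refine ⟨fun p q r => u₁ p q * a r, fun p q r => u₂ p r * b q, C,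
      Submodule.mem_map.mpr ⟨(a, b), hab, by rw [hL]⟩, hC, ?_⟩
    funext p q r
    simp only [Pi.add_apply]
    exact hT p q r)
  exact h.trans (Submodule.finrank_map_le L AB)

/-- **Common subspace version.**  If moreover all the vectors `a, b` lie in one subspace `Y ⊂ ℂ⁵`, then `finrank W ≤ 2 · finrank Y`;
the binary-plane branch of profile `(1,1,2)` (`u₁, u₂ ∈ Sym²Y`, `finrank Y ≤ 2`) thus gives `finrank W ≤ 4`. [folklore] -/
theorem finrank_le_two_mul_of_vectors_mem (u₁ u₂ : Fin 5 → Fin 5 → ℂ) (U12 W : Submodule ℂ (Fin 5 → Fin 5 → ℂ))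
    (v v' : Fin 5 → Fin 5 → ℂ) (hv : ∀ p q, v p q = v q p) (hv' : ∀ p q, v' p q = v' q p)
    (hV : ∀ x ∈ U12, ∃ c c' : ℂ, x = c • v + c' • v')
    (hWs : ∀ μ ∈ W, ∀ s t : Fin 5, μ s t = μ t s) (hWd : ∀ μ ∈ W, ∀ s : Fin 5, μ s s = 0)
    (Y : Submodule ℂ (Fin 5 → ℂ))
    (hrep : ∀ μ ∈ W, ∃ a ∈ Y, ∃ b ∈ Y, ∃ C : Fin 5 → Fin 5 → Fin 5 → ℂ, (∀ p, C p ∈ U12) ∧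
      ∀ p q r, contractZ μ p q r = u₁ p q * a r + u₂ p r * b q + C p q r) :
    Module.finrank ℂ W ≤ 2 * Module.finrank ℂ Y := by
  have h := finrank_le_of_vectorPart u₁ u₂ U12 W v v' hv hv' hV hWs hWd (Y.prod Y) (fun μ hμ => by
    obtain ⟨a, ha, b, hb, C, hC, hT⟩ := hrep μ hμ
    exact ⟨a, b, C, Submodule.mem_prod.mpr ⟨ha, hb⟩, hC, hT⟩)
  have h2 : Module.finrank ℂ (Y.prod Y) ≤ Module.finrank ℂ Y + Module.finrank ℂ Y := by
    rw [LinearMap.prod_eq_sup_map]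
    exact (Submodule.finrank_add_le_finrank_add_finrank _ _).trans
      (add_le_add (Submodule.finrank_map_le _ _) (Submodule.finrank_map_le _ _))
  omega

/-- Reading of profile `(1,1,·)`: a member of `L₃(ℂu₁, ℂu₂, U₁₂)` is `u₁(p,q)a_r + u₂(p,r)b_q + C_p(q,r)` with every `C_p ∈ U₁₂`.
[folklore] -/
theorem vectors_form_of_mem_L3 (u₁ u₂ : Fin 5 → Fin 5 → ℂ) (U12 : Submodule ℂ (Fin 5 → Fin 5 → ℂ))
    {T : Fin 5 → Fin 5 → Fin 5 → ℂ} (hT : T ∈ L3 (ℂ ∙ u₁) (ℂ ∙ u₂) U12) :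
    ∃ a b : Fin 5 → ℂ, ∃ C : Fin 5 → Fin 5 → Fin 5 → ℂ, (∀ p, C p ∈ U12) ∧
      ∀ p q r, T p q r = u₁ p q * a r + u₂ p r * b q + C p q r := by
  obtain ⟨A, B, C, hA, hB, hC, hT⟩ := L3_finite_form _ _ _ hT
  have hA' : ∀ r, ∃ κ : ℂ, κ • u₁ = A r := fun r => Submodule.mem_span_singleton.mp (hA r)
  have hB' : ∀ r, ∃ κ : ℂ, κ • u₂ = B r := fun r => Submodule.mem_span_singleton.mp (hB r)
  choose a ha using hA'
  choose b hb using hB'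
  refine ⟨a, b, C, hC, fun p q r => ?_⟩
  rw [hT p q r, ← ha r, ← hb q]
  simp only [Pi.smul_apply, smul_eq_mul]
  ring

/-- A space of symmetric matrices of dimension `≤ 2` lies in the span of two symmetric matrices. [folklore] -/
theorem exists_pair_of_finrank_le_two (U : Submodule ℂ (Fin 5 → Fin 5 → ℂ)) (hU : ∀ x ∈ U, ∀ p q : Fin 5, x p q = x q p)
    (h2 : Module.finrank ℂ U ≤ 2) :
    ∃ v v' : Fin 5 → Fin 5 → ℂ, (∀ p q, v p q = v q p) ∧ (∀ p q, v' p q = v' q p) ∧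
      ∀ x ∈ U, ∃ c c' : ℂ, x = c • v + c' • v' := by
  have hz : ∀ p q : Fin 5, (0 : Fin 5 → Fin 5 → ℂ) p q = (0 : Fin 5 → Fin 5 → ℂ) q p := fun p q => rfl
  rcases Nat.lt_or_ge (Module.finrank ℂ U) 1 with h0 | h1
  · -- `U = ⊥`
    have hbot : U = ⊥ := Submodule.finrank_eq_zero.mp (by omega)
    refine ⟨0, 0, hz, hz, fun x hx => ⟨0, 0, ?_⟩⟩
    rw [hbot, Submodule.mem_bot] at hx
    rw [hx]; simp
  rcases Nat.lt_or_ge (Module.finrank ℂ U) 2 with h1' | h2'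
  · -- dimension one
    let bs := Module.finBasisOfFinrankEq ℂ U (show Module.finrank ℂ U = 1 by omega)
    refine ⟨(bs 0 : U), 0, hU _ (bs 0).2, hz, fun x hx => ⟨bs.repr ⟨x, hx⟩ 0, 0, ?_⟩⟩
    have h := bs.sum_repr ⟨x, hx⟩
    rw [Fin.sum_univ_one] at h
    have h' := congrArg Subtype.val h
    simp only [Submodule.coe_smul] at h'
    rw [zero_smul, add_zero]; exact h'.symm
  · -- dimension two
    let bs := Module.finBasisOfFinrankEq ℂ U (show Module.finrank ℂ U = 2 by omega)
    refine ⟨(bs 0 : U), (bs 1 : U), hU _ (bs 0).2, hU _ (bs 1).2, fun x hx => ⟨bs.repr ⟨x, hx⟩ 0, bs.repr ⟨x, hx⟩ 1, ?_⟩⟩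
    have h := bs.sum_repr ⟨x, hx⟩
    rw [Fin.sum_univ_two] at h
    have h' := congrArg Subtype.val h
    simp only [Submodule.coe_add, Submodule.coe_smul] at h'
    exact h'.symm

/-- ★ **THE INSTANCE IN `CaptureIneqSym` CURRENCY.**  `U₀₁, U₀₂` arbitrary, `U₁₂` symmetric of dimension `≤ 2`, `W` symmetric
zero-diagonal captured by `L3 U₀₁ U₀₂ U₁₂`.  ANY submodule `AB` containing the placed pair part
`((p,q,r) ↦ A_r(p,q), (p,q,r) ↦ B_q(p,r))` of every finite-form representation `T_μ = A_r(p,q) + B_q(p,r) + C_p(q,r)`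
(`A_r ∈ U₀₁`, `B_q ∈ U₀₂`, `C_p ∈ U₁₂`, ✓ `L3_finite_form`) of every obligation satisfies `finrank W ≤ finrank AB` — the minimal such
`AB` is the pair projection of the representation space; the next bricks feed the pencil space (`pairPart_pencil`) or `Y × Y`. [folklore] -/
theorem finrank_le_of_pairs_mem (U01 U02 U12 W : Submodule ℂ (Fin 5 → Fin 5 → ℂ))
    (hU12 : ∀ x ∈ U12, ∀ p q : Fin 5, x p q = x q p) (h2 : Module.finrank ℂ U12 ≤ 2)
    (hWs : ∀ μ ∈ W, ∀ s t : Fin 5, μ s t = μ t s) (hWd : ∀ μ ∈ W, ∀ s : Fin 5, μ s s = 0)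
    (hWc : ∀ μ ∈ W, contractZ μ ∈ L3 U01 U02 U12)
    (AB : Submodule ℂ ((Fin 5 → Fin 5 → Fin 5 → ℂ) × (Fin 5 → Fin 5 → Fin 5 → ℂ)))
    (hAB : ∀ μ ∈ W, ∀ A B C : Fin 5 → Fin 5 → Fin 5 → ℂ, (∀ r, A r ∈ U01) → (∀ q, B q ∈ U02) → (∀ p, C p ∈ U12) →
      (∀ p q r, contractZ μ p q r = A r p q + B q p r + C p q r) →
      ((fun p q r => A r p q, fun p q r => B q p r) : (Fin 5 → Fin 5 → Fin 5 → ℂ) × (Fin 5 → Fin 5 → Fin 5 → ℂ)) ∈ AB) :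
    Module.finrank ℂ W ≤ Module.finrank ℂ AB := by
  obtain ⟨v, v', hv, hv', hV⟩ := exists_pair_of_finrank_le_two U12 hU12 h2
  refine finrank_le_of_pairPart U12 W v v' hv hv' hV hWs hWd AB fun μ hμ => ?_
  obtain ⟨A, B, C, hA, hB, hC, hT⟩ := L3_finite_form U01 U02 U12 (hWc μ hμ)
  refine ⟨fun p q r => A r p q, fun p q r => B q p r, C, hAB μ hμ A B C hA hB hC hT, hC, ?_⟩
  funext p q r
  simp only [Pi.add_apply]
  exact hT p q r

/-- **The pair part satisfies the pencil equations.**  For a representation `T_μ = A_r(p,q) + B_q(p,r) + C_p(q,r)` with symmetric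
`C_p`, the `(1 2)`-slot symmetry of the obligation reads `A_r(p,q) + B_q(p,r) = A_q(p,r) + B_r(p,q)` (for lines
`A_r = a_r u₁`, `B_q = b_q u₂` this is ✓ `pencil_twoTerm`). [folklore] -/
theorem pairPart_pencil (U12 : Submodule ℂ (Fin 5 → Fin 5 → ℂ)) (hU12 : ∀ x ∈ U12, ∀ p q : Fin 5, x p q = x q p)
    (μ : Fin 5 → Fin 5 → ℂ) (A B C : Fin 5 → Fin 5 → Fin 5 → ℂ) (hC : ∀ p, C p ∈ U12)
    (hT : ∀ p q r, contractZ μ p q r = A r p q + B q p r + C p q r) (p q r : Fin 5) :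
    A r p q + B q p r = A q p r + B r p q := by
  have h := contractZ_swap23 μ p q r
  rw [hT, hT] at h
  have hc := hU12 _ (hC p) q r
  linear_combination h.symm - hc

end LaplaceFiveSeparatedCapture

end Summit.ValiantsHypothesis.ValiantsHypothesis.Theorems.RigidityForcesSymmetryRankRigidMinimalRepr
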